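import Mathlib
import HarnessLib
import Summits.ResolutionOfSingularities.ResolutionOfSingularities.Theorems.HomologicalConductorSurfaceTerminationCaptureDescent

/-!
# Kill test `SurfaceTermination` (stmt-ResolutionOfSingularities-16488): the E-descent on ONE resolution,
# with the BOUND — at most `#{integral exceptional curves} + 1` further singular stages

Route `ResolutionOfSingularities/HomologicalConductor`, support item `SurfaceTermination`
(stmt-ResolutionOfSingularities-16488), line `genus-descent`.  OURS (hand leafhand-res-homologicalconduct-20,
2026-08-31); nothing here is a statement of the manuscript under review (Hironaka 2017); AI-written, weaker than
expert review.  Sequel to `…SurfaceTerminationCaptureDescent` (`termination_of_capture`, p830771).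

Two sharpenings of the fact-free E-descent, both read off the proof of
`Descent.rationalStageTermination` (res-L0-w44, K44S-DESCENT (R2)):

* **WHERE capture is needed.**  The descent fixes ONE resolution `π : X ⟶ Spec T_(m₁+1)` of the singular stage and
  consumes «`ca(T_i)·S` principal» only for `S = 𝒪_{X,x} ⊆ K` a local ring of THAT `X` containing and
  dominating the later singular stage `T_i` (the centre on `X` of the exit divisor of a step).  With the local
  rings of `X` placed inside `K` by the (unique) `T_(m₁+1)`-isomorphism `e : K(X) ≃ K`
  (`𝒪_{X,x} ↦ e(range (𝒪_{X,x} → K(X)))`, the tree's `CentreRing` dictionary), this is the hypothesis of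
  `exists_regular_le_of_capture_on_resolution` — «SIMULTANEOUS PRINCIPALIZATION of the later `ca`'s by one
  resolution of `T_(m₁+1)`».  Unlike universal CAPTURE (every regular local `S` dominating `T_i`, THEOREM A's
  shape, which fails at base points of `ca` on the minimal resolution of a non-rational stage), this hypothesis
  is implied back by termination (a terminating tower has finitely many singular stages; resolve them jointly), so
  it is the honest kernel of the kill test in descent form.
* **HOW LONG the tower can stay singular.**  The measure `E j` injects into the integral exceptional curves of
  `X`, so the descent yields a regular stage `T_m` with `m ≤ m₁ + 2 + #excCurvePoints π`:
  `exists_regular_le_of_capture_on_resolution`, `exists_regular_le_of_capture` (universal CAPTURE, any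
  resolution), and — modulo the six named facts of the line — `exists_regular_le_of_hasRationalSingularity`:
  above a RATIONAL singular stage `T_(m₁+1)` the canonical `ca`-tower is regular after at most
  `#{integral exceptional curves of ANY resolution of T_(m₁+1)} + 1` further steps (e.g. for a resolution with
  `n` exceptional curves, `T_(m₁+n+2)` is regular), along every valuation.

No new definitions; the only named-fact hypotheses are in the rational corollary.

References: J. Lipman, Publ. Math. IHÉS 36 (1969), (1.1), (1.2), (4.1), §12 [`Lipman1969`]; O. Zariski,
P. Samuel, *Commutative Algebra* II (1960), Ch. VI §17 [`ZariskiSamuel1960`]; R. Hartshorne, *Algebraic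
Geometry* (1977), proof of Cor. III.11.4 (`K(X) = Frac T`) [`Hartshorne1977`].
-/

noncomputable section

-- single-problem summit: the doubled namespace component `ResolutionOfSingularities` is forced
set_option linter.dupNamespace false

namespace Summit.ResolutionOfSingularities.ResolutionOfSingularities.Theorems.SurfaceTermination.CaptureDescent

open CategoryTheory AlgebraicGeometry IsLocalRing
open Literature.AlgebraicGeometry.Resolution Literature.AlgebraicGeometry.Motives
open Literature.RingTheory.CohomologyAnnihilator (cohomologyAnnihilator)
open Summit.ResolutionOfSingularities.ResolutionOfSingularities.Theorems.NoZeno.Birth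
open Summit.ResolutionOfSingularities.ResolutionOfSingularities.Theorems.NoZeno.SandwichCluster
open Summit.ResolutionOfSingularities.ResolutionOfSingularities.Theorems.SurfaceTermination.Descent
open Summit.ResolutionOfSingularities.ResolutionOfSingularities.Theorems.SurfaceTermination.CentreRing

variable {k K : Type} [Field k] [Field K] [Algebra k K]

/-! ## The descent on one resolution, with the bound -/

/-- **SIMULTANEOUS PRINCIPALIZATION on ONE resolution ⇒ TERMINATION, with the bound (fact-free).**  Route datum
(`k ⊆ O`, `A` finitely generated, `Frac A = K`, `A ⊆ O`, `ringKrullDim A = 2`), ANY valuation ring `O`; a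
singular stage `T_(m₁+1)` (a local ring — instance binder, cf. `NoZeno.Birth` / `SyzygyFlattening.isLocalRing_locAt`) with a resolution `π : X ⟶ Spec T_(m₁+1)` (`X` integral) and the `T_(m₁+1)`-isomorphism
`e : K(X) ≃ K`.  HYPOTHESIS: for every later singular stage `T_i` (`i ≥ m₁ + 1`) and every point `x ∈ X` whose
local ring `S = 𝒪_{X,x} ⊆ K` (`S.toSubring = e(range(𝒪_{X,x} → K(X)))`; it is regular local and essentially of
finite type over `k`, offered as hypotheses) contains and dominates `T_i`, the ideal `ca(T_i)·S` is principal.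
CONCLUSION: `T_m` is a regular local ring for some `m ≤ m₁ + 2 + #excCurvePoints π`.  Proof: the E-descent —
`E j` = proper valuation rings of `K` relatively dominating `T_j` that are local rings of `X`; `E (m₁+1)` injects
into `excCurvePoints π` (curve detection), `E` is antitone, and every singular step `T_j ↦ T_(j+1)` loses its exit
divisor `W` (capture at the centre of `W` on `X` + the step lemma put all stages up to `T_(j+1)` inside that
centre ring, which is then `W`); count. [cite: ZariskiSamuel1960, Ch. VI §17] -/
theorem exists_regular_le_of_capture_on_resolution
    (O : ValuationSubring K) (A : Subalgebra k K) (hk : ∀ c : k, algebraMap k K c ∈ O) (hA : A.FG)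
    (hfr : IsFractionRing ↥A K) (hAO : A.toSubring ≤ O.toSubring) (hdimA : ringKrullDim ↥A = 2)
    (m₁ : ℕ) (hsing₁ : ¬ IsRegularLocalRing ↥(tower O A (m₁ + 1))) [IsLocalRing ↥(tower O A (m₁ + 1))]
    (X : Scheme.{0}) [IsIntegral X] (π : X ⟶ Spec (.of ↥(tower O A (m₁ + 1)))) (hπ : IsResolution π)
    (e : ↑X.functionField ≃+* K) (he : ∀ t : ↥(tower O A (m₁ + 1)), e (baseToFunctionField π t) = (t : K))
    (hcap : ∀ i : ℕ, m₁ + 1 ≤ i → ¬ IsRegularLocalRing ↥(tower O A i) →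
      ∀ (x : X) (S : Subalgebra k K) (hTS : tower O A i ≤ S),
        S.toSubring = ((RatFn.toFunctionField x).range).map e.toRingHom →
        (∀ t ∈ tower O A i, t⁻¹ ∈ S → t⁻¹ ∈ tower O A i) →
        IsRegularLocalRing ↥S → Algebra.EssFiniteType k ↥S →
        (Ideal.map (Subalgebra.inclusion hTS).toRingHom (cohomologyAnnihilator ↥(tower O A i))).IsPrincipal) :
    ∃ m : ℕ, m ≤ m₁ + 2 + (excCurvePoints π).ncard ∧ IsRegularLocalRing ↥(tower O A m) := by
  classical
  haveI := hfr
  have htr : Algebra.trdeg k K = 2 := trdeg_eq_two_of_ringKrullDim A hA hfr hdimA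
  have hmono : ∀ {i j : ℕ}, i ≤ j → tower O A i ≤ tower O A j :=
    fun hij _ hx => d2rc_mem_tower_of_le O A hij hx
  have hTO : ∀ (j : ℕ) (t : K), t ∈ tower O A j → t ∈ O :=
    fun j t ht => mem_valuationSubring_of_mem_tower O hk hAO j t ht
  -- stages are dominated by `O`
  have inv_mem_tower_of_inv_mem : ∀ (j : ℕ) {t : K}, t ∈ tower O A j → t⁻¹ ∈ O → t⁻¹ ∈ tower O A j := by
    intro j t ht hti
    by_cases ht0 : t = 0
    · subst ht0; rw [inv_zero]; exact (tower O A j).zero_mem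
    obtain ⟨B, hBO, hTB⟩ := exists_tower_eq_loc O A hk hAO j
    have htO : t ∈ O := hTO j t ht
    rw [hTB, loc_eq_locAt] at ht ⊢
    exact SyzygyFlattening.inv_mem_locAt O B hBO ht
      (SyzygyFlattening.valuation_eq_one_of_inv_mem O htO hti ht0)
  -- the stage package at `m₁ + 1`
  haveI : IsNoetherianRing ↥(tower O A (m₁ + 1)) := stub_towerNoetherian k K O A hk hA hfr hAO _
  have hdimT : ringKrullDim ↥(tower O A (m₁ + 1)) = 2 :=
    ringKrullDim_tower_eq_two_of_not_isRegularLocalRing O A hk hA hfr hAO htr m₁ hsing₁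
  haveI : IsIntegrallyClosed ↥(tower O A (m₁ + 1)) := d2rc_isIntegrallyClosed_tower_succ O A hk hA hfr hAO m₁
  haveI : IsFractionRing ↥(tower O A (m₁ + 1)) K :=
    isFractionRing_subalgebra_of_le A (tower O A (m₁ + 1)) (tn_tower_invariant O A hk hA hfr hAO (m₁ + 1)).1
  have hET : Algebra.EssFiniteType k ↥(tower O A (m₁ + 1)) :=
    (tn_tower_invariant O A hk hA hfr hAO (m₁ + 1)).2.2
  haveI : IsProper π := hπ.isProper
  have hexcfin : (excCurvePoints π).Finite :=
    (excPoints_finite π).subset (hπ.excCurvePoints_subset_excPoints hdimT)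
  -- the centre rings of `X` inside `K`, through the given `e`
  let ctr : X → Subalgebra k K := fun x =>
    { toSubsemiring := (((RatFn.toFunctionField x).range).map e.toRingHom).toSubsemiring
      algebraMap_mem' := fun c =>
        toSubring_le_stalkSubring (tower O A (m₁ + 1)) π e he x
          (Subalgebra.mem_toSubring.mpr ((tower O A (m₁ + 1)).algebraMap_mem c)) }
  have hctr : ∀ x, (ctr x).toSubring = ((RatFn.toFunctionField x).range).map e.toRingHom :=
    fun x => SetLike.coe_injective rfl
  have hmem : ∀ x (z : K), z ∈ ctr x ↔ z ∈ ((RatFn.toFunctionField x).range).map e.toRingHom :=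
    fun x z => Iff.rfl
  have hctrT : ∀ x, tower O A (m₁ + 1) ≤ ctr x := fun x t ht =>
    (hmem x t).mpr (toSubring_le_stalkSubring (tower O A (m₁ + 1)) π e he x (Subalgebra.mem_toSubring.mpr ht))
  have hctrReg : ∀ x, IsRegularLocalRing ↥(ctr x) := by
    intro x
    haveI := hπ.isRegular x
    haveI := isRegularLocalRing_stalkSubring e x
    exact IsRegularLocalRing.of_ringEquiv (R := ↥(((RatFn.toFunctionField x).range).map e.toRingHom))
      ((RingEquiv.subringCongr (hctr x).symm).trans (RingEquiv.refl _))
  have hctrInt : ∀ x, ∀ y : K, IsIntegral ↥(ctr x) y → y ∈ ctr x := by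
    intro x y hy
    haveI := hπ.isRegular x
    exact mem_of_isIntegral (tower O A (m₁ + 1)) π e he x (ctr x) (hctr x) y hy
  have hctrEft : ∀ x, Algebra.EssFiniteType k ↥(ctr x) :=
    fun x => essFiniteType_of (tower O A (m₁ + 1)) π e he hET x (ctr x) (hctr x)
  have hcentre : ∀ V : ValuationSubring K, (tower O A (m₁ + 1)).toSubring ≤ V.toSubring →
      ∃ x, (ctr x).toSubring ≤ V.toSubring ∧ ∀ s ∈ ctr x, s⁻¹ ∈ V → s⁻¹ ∈ ctr x := by
    intro V hTV
    obtain ⟨x, hxV, hdom⟩ := exists_centre (tower O A (m₁ + 1)) π e he V hTV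
    exact ⟨x, fun z hz => hxV ((hmem x z).mp (Subalgebra.mem_toSubring.mp hz)),
      fun z hz hzi => (hmem x _).mpr (hdom z ((hmem x z).mp hz) hzi)⟩
  have hcurve : ∀ x, ∀ V : ValuationSubring K, V ≠ ⊤ →
      (∀ t ∈ tower O A (m₁ + 1), t⁻¹ ∈ V → t⁻¹ ∈ tower O A (m₁ + 1)) →
      ((ctr x : Set K) = (V : Set K)) → x ∈ excCurvePoints π :=
    fun x V hV hdomT heq =>
      mem_excCurvePoints_of_coe_eq (tower O A (m₁ + 1)) π e he hdimT hsing₁ hπ x V hV hdomT heq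
  -- the measure
  let E : ℕ → Set (ValuationSubring K) := fun j =>
    {V | V ≠ ⊤ ∧ (tower O A j).toSubring ≤ V.toSubring ∧
      (∀ t ∈ tower O A j, t⁻¹ ∈ V → t⁻¹ ∈ tower O A j) ∧ ∃ x, ((ctr x : Set K) = (V : Set K))}
  have hE : ∀ j V, V ∈ E j ↔ (V ≠ ⊤ ∧ (tower O A j).toSubring ≤ V.toSubring ∧
      (∀ t ∈ tower O A j, t⁻¹ ∈ V → t⁻¹ ∈ tower O A j) ∧ ∃ x, ((ctr x : Set K) = (V : Set K))) :=
    fun j V => Iff.rfl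
  -- (F1) `E (m₁+1)` injects into the integral exceptional curves: finite, and counted
  have hsubimg : ((fun V : ValuationSubring K => (V : Set K)) '' E (m₁ + 1)) ⊆
      ((fun x => ((ctr x : Subalgebra k K) : Set K)) '' excCurvePoints π) := by
    rintro _ ⟨V, hV, rfl⟩
    obtain ⟨hVtop, -, hVdom, x, hx⟩ := (hE _ V).mp hV
    exact ⟨x, hcurve x V hVtop hVdom hx, hx⟩
  have himgfin : ((fun x => ((ctr x : Subalgebra k K) : Set K)) '' excCurvePoints π).Finite :=
    hexcfin.image _
  have hfin : (E (m₁ + 1)).Finite :=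
    Set.Finite.of_finite_image (himgfin.subset hsubimg) (Set.injOn_of_injective SetLike.coe_injective)
  have hcard : (E (m₁ + 1)).ncard ≤ (excCurvePoints π).ncard := by
    calc (E (m₁ + 1)).ncard
        = ((fun V : ValuationSubring K => (V : Set K)) '' E (m₁ + 1)).ncard :=
          (Set.ncard_image_of_injective _ SetLike.coe_injective).symm
      _ ≤ ((fun x => ((ctr x : Subalgebra k K) : Set K)) '' excCurvePoints π).ncard :=
          Set.ncard_le_ncard hsubimg himgfin
      _ ≤ (excCurvePoints π).ncard := Set.ncard_image_le hexcfin
  -- (F2) antitone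
  have hanti : ∀ j, E (j + 1) ⊆ E j := by
    intro j V hV
    obtain ⟨hVtop, hTV, hVdom, hx⟩ := (hE _ V).mp hV
    refine (hE _ V).mpr ⟨hVtop, fun t ht => hTV (Subalgebra.mem_toSubring.mpr (hmono (Nat.le_succ j) ht)),
      fun t ht hti => ?_, hx⟩
    have h1 : t⁻¹ ∈ tower O A (j + 1) := hVdom t (hmono (Nat.le_succ j) ht) hti
    exact inv_mem_tower_of_inv_mem j ht (hTO _ _ h1)
  -- singular stages below a singular stage
  have hsing_of_le : ∀ {i j : ℕ}, i ≤ j → ¬ IsRegularLocalRing ↥(tower O A j) →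
      ¬ IsRegularLocalRing ↥(tower O A i) :=
    fun hij hj hi => hj (isRegularLocalRing_tower_of_le O A hk hfr hAO hij hi)
  -- (F3) strictness at a singular step: the exit divisor is lost
  have hstrict : ∀ j, m₁ + 1 ≤ j → ¬ IsRegularLocalRing ↥(tower O A (j + 1)) →
      ∃ W ∈ E j, W ∉ E (j + 1) := by
    intro j hj hsingj
    obtain ⟨n, rfl⟩ : ∃ n, j = n + 1 := ⟨j - 1, by omega⟩
    obtain ⟨W, hWtop, -, hTW, hgen, hdomW, ⟨t₀, ht₀, ht₀i, ht₀n⟩, -⟩ :=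
      exists_exitDivisor O A hk hA hfr hAO htr n hsingj
    have hTW' : ∀ {i : ℕ}, i ≤ n + 1 + 1 → (tower O A i).toSubring ≤ W.toSubring :=
      fun hi t ht => hTW (Subalgebra.mem_toSubring.mpr (hmono hi ht))
    refine ⟨W, (hE _ W).mpr ⟨hWtop, hTW' (Nat.le_succ _), hdomW, ?_⟩, fun hW => ?_⟩
    swap
    · obtain ⟨-, -, hdom', -⟩ := (hE _ W).mp hW
      exact ht₀n (hdom' t₀ ht₀ ht₀i)
    obtain ⟨x, hxW, hxdom⟩ := hcentre W (hTW' (by omega))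
    refine ⟨x, ?_⟩
    -- every stage up to `T_(j+1)` lies in `S := ctr x` (capture at `x` + step lemma)
    have hstages : ∀ i, m₁ + 1 ≤ i → i ≤ n + 1 + 1 → tower O A i ≤ ctr x := by
      intro i hi
      induction i, hi using Nat.le_induction with
      | base => exact fun _ => hctrT x
      | succ i hi ih =>
        intro hi'
        have hTS : tower O A i ≤ ctr x := ih (by omega)
        obtain ⟨d, rfl⟩ : ∃ d, i = d + 1 := ⟨i - 1, by omega⟩
        have hsingi : ¬ IsRegularLocalRing ↥(tower O A (d + 1)) := hsing_of_le (by omega) hsingj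
        have hdomS : ∀ t ∈ tower O A (d + 1), t⁻¹ ∈ ctr x → t⁻¹ ∈ tower O A (d + 1) := by
          intro t ht hti
          have h1 : t⁻¹ ∈ tower O A (n + 1) :=
            hdomW t (hmono (by omega) ht) (hxW (Subalgebra.mem_toSubring.mpr hti))
          exact inv_mem_tower_of_inv_mem _ ht (hTO _ _ h1)
        have hprinc := hcap (d + 1) hi hsingi x (ctr x) hTS (hctr x) hdomS (hctrReg x) (hctrEft x)
        exact SurfaceTermination.tower_succ_le_of_isPrincipal O A (d + 1) W.toSubring (hTW' hi') (ctr x) hTS hxW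
          hxdom (hctrInt x) hprinc
    have hTjS : tower O A (n + 1 + 1) ≤ ctr x := hstages (n + 1 + 1) (by omega) le_rfl
    refine Set.Subset.antisymm (fun s hs => hxW (Subalgebra.mem_toSubring.mpr hs)) ?_
    intro w hw
    obtain ⟨a, ha, s, hs, hsi, rfl⟩ := hgen w hw
    exact (ctr x).mul_mem (hTjS ha) (hxdom s (hTjS hs) hsi)
  -- (F4) the counted descent
  have key : ∀ (c j : ℕ), m₁ + 1 ≤ j → (E j).Finite → (E j).ncard ≤ c →
      ∃ m : ℕ, m ≤ j + c + 1 ∧ IsRegularLocalRing ↥(tower O A m) := by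
    intro c
    induction c with
    | zero =>
      intro j hj hfinj hcard
      by_cases hreg : IsRegularLocalRing ↥(tower O A (j + 1))
      · exact ⟨j + 1, by omega, hreg⟩
      obtain ⟨W, hW, -⟩ := hstrict j hj hreg
      have h0 : E j = ∅ := (Set.ncard_eq_zero hfinj).mp (Nat.le_zero.mp hcard)
      rw [h0] at hW
      exact absurd hW (Set.notMem_empty W)
    | succ c ih =>
      intro j hj hfinj hcard
      by_cases hreg : IsRegularLocalRing ↥(tower O A (j + 1))
      · exact ⟨j + 1, by omega, hreg⟩
      obtain ⟨W, hWj, hWj1⟩ := hstrict j hj hreg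
      have hsub : E (j + 1) ⊆ E j := hanti j
      have hlt : (E (j + 1)).ncard < (E j).ncard :=
        Set.ncard_lt_ncard (Set.ssubset_iff_subset_ne.mpr ⟨hsub, fun h => hWj1 (h ▸ hWj)⟩) hfinj
      obtain ⟨m, hm, hreg'⟩ := ih (j + 1) (by omega) (hfinj.subset hsub) (by omega)
      exact ⟨m, by omega, hreg'⟩
  obtain ⟨m, hm, hreg⟩ := key _ (m₁ + 1) le_rfl hfin le_rfl
  exact ⟨m, by omega, hreg⟩

/-- **Universal CAPTURE ⇒ a regular stage within `#excCurvePoints π + 1` further steps (fact-free).**  For ANY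
resolution `π : X ⟶ Spec T_(m₁+1)` of a singular stage: if `ca(T_i)·S` is principal for every later singular
stage `T_i` and every regular local `k`-subalgebra `S ⊇ T_i` of `K`, essentially of finite type and dominating
`T_i` (THEOREM A's shape), then `T_m` is regular for some `m ≤ m₁ + 2 + #excCurvePoints π`.  The
`T_(m₁+1)`-isomorphism `K(X) ≃ K` is produced here (`isFractionRing_baseToFunctionField`, `K(X) = Frac T`).
[cite: Hartshorne1977, proof of Cor. III.11.4 (p. 280)] -/
theorem exists_regular_le_of_capture
    (O : ValuationSubring K) (A : Subalgebra k K) (hk : ∀ c : k, algebraMap k K c ∈ O) (hA : A.FG)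
    (hfr : IsFractionRing ↥A K) (hAO : A.toSubring ≤ O.toSubring) (hdimA : ringKrullDim ↥A = 2)
    (m₁ : ℕ) (hsing₁ : ¬ IsRegularLocalRing ↥(tower O A (m₁ + 1))) [IsLocalRing ↥(tower O A (m₁ + 1))]
    (X : Scheme.{0}) (π : X ⟶ Spec (.of ↥(tower O A (m₁ + 1)))) (hπ : IsResolution π)
    (hcap : ∀ i : ℕ, m₁ + 1 ≤ i → ¬ IsRegularLocalRing ↥(tower O A i) →
      ∀ (S : Subalgebra k K) (hTS : tower O A i ≤ S),
        (∀ t ∈ tower O A i, t⁻¹ ∈ S → t⁻¹ ∈ tower O A i) →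
        IsRegularLocalRing ↥S → Algebra.EssFiniteType k ↥S →
        (Ideal.map (Subalgebra.inclusion hTS).toRingHom (cohomologyAnnihilator ↥(tower O A i))).IsPrincipal) :
    ∃ m : ℕ, m ≤ m₁ + 2 + (excCurvePoints π).ncard ∧ IsRegularLocalRing ↥(tower O A m) := by
  haveI := hfr
  haveI : IsFractionRing ↥(tower O A (m₁ + 1)) K :=
    isFractionRing_subalgebra_of_le A (tower O A (m₁ + 1)) (tn_tower_invariant O A hk hA hfr hAO (m₁ + 1)).1
  haveI : IsIntegral X := hπ.isIntegral_source
  -- `K(X) ≅ K` over the stage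
  letI := (baseToFunctionField π).toAlgebra
  haveI := hπ.isBirational.isDominant
  haveI : IsFractionRing ↥(tower O A (m₁ + 1)) ↑X.functionField :=
    isFractionRing_baseToFunctionField π hπ.isBirational.isIso_stalkMap_genericPoint
  let eA : ↑X.functionField ≃ₐ[↥(tower O A (m₁ + 1))] K :=
    IsLocalization.algEquiv (nonZeroDivisors ↥(tower O A (m₁ + 1))) _ _
  have he : ∀ t : ↥(tower O A (m₁ + 1)), eA.toRingEquiv (baseToFunctionField π t) = (t : K) :=
    fun t => eA.commutes t
  exact exists_regular_le_of_capture_on_resolution O A hk hA hfr hAO hdimA m₁ hsing₁ X π hπ eA.toRingEquiv he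
    (fun i hi hsing x S hTS _ hdom hreg heft => hcap i hi hsing S hTS hdom hreg heft)

/-! ## The rational case, counted -/

/-- **Above a RATIONAL singular stage the `ca`-tower is regular after at most
`#{integral exceptional curves of any resolution} + 1` further steps** (modulo the six named facts of the line).
For the route's datum with `ringKrullDim A = 2`, ANY valuation ring `O`, a singular stage `T_(m₁+1)` with a
rational singularity and ANY resolution `π : X ⟶ Spec T_(m₁+1)`: `T_m` is a regular local ring for some
`m ≤ m₁ + 2 + #excCurvePoints π`.  CAPTURE at the later singular stages is THEOREM A
(`RationalDescent.isPrincipal_map_ca_of_isRegularLocalRing_dominating`), rationality propagating by Lipman (1.2)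
(`RationalDescent.hasRationalSingularity_tower_succ`).  Quantitative form of `Descent.rationalStageTermination`.
[cite: Lipman1969, Proposition (1.2) and Theorem (4.1) (pp. 199, 204)] -/
theorem exists_regular_le_of_hasRationalSingularity
    (hF : (CossartJannsenSaito2020General.{0} ∧ Lipman1969_1_2.{0} ∧ Lipman1969_4_1.{0} ∧
      Lipman1969_12_1_i.{0} ∧ Lipman1969_12_1_ii.{0} ∧
      Literature.AlgebraicGeometry.Morphisms.GortzWedhorn2023_24_44_H2.{0}))
    (O : ValuationSubring K) (A : Subalgebra k K) (hk : ∀ c : k, algebraMap k K c ∈ O) (hA : A.FG)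
    (hfr : IsFractionRing ↥A K) (hAO : A.toSubring ≤ O.toSubring) (hdimA : ringKrullDim ↥A = 2)
    (m₁ : ℕ) (hsing₁ : ¬ IsRegularLocalRing ↥(tower O A (m₁ + 1))) [IsLocalRing ↥(tower O A (m₁ + 1))]
    (hrat₁ : HasRationalSingularity ↥(tower O A (m₁ + 1)))
    (X : Scheme.{0}) (π : X ⟶ Spec (.of ↥(tower O A (m₁ + 1)))) (hπ : IsResolution π) :
    ∃ m : ℕ, m ≤ m₁ + 2 + (excCurvePoints π).ncard ∧ IsRegularLocalRing ↥(tower O A m) := by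
  have h12 : Lipman1969_1_2.{0} := hF.2.1
  have htr : Algebra.trdeg k K = 2 := trdeg_eq_two_of_ringKrullDim A hA hfr hdimA
  have hsing_of_le : ∀ {i j : ℕ}, i ≤ j → ¬ IsRegularLocalRing ↥(tower O A j) →
      ¬ IsRegularLocalRing ↥(tower O A i) :=
    fun hij hj hi => hj (isRegularLocalRing_tower_of_le O A hk hfr hAO hij hi)
  have hrat_of : ∀ i, m₁ + 1 ≤ i → ¬ IsRegularLocalRing ↥(tower O A i) →
      HasRationalSingularity ↥(tower O A i) := by
    intro i hi
    induction i, hi using Nat.le_induction with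
    | base => exact fun _ => hrat₁
    | succ i hi ih =>
      intro hsing'
      obtain ⟨n, rfl⟩ : ∃ n, i = n + 1 := ⟨i - 1, by omega⟩
      have hsing : ¬ IsRegularLocalRing ↥(tower O A (n + 1)) := hsing_of_le (Nat.le_succ _) hsing'
      exact RationalDescent.hasRationalSingularity_tower_succ h12 O A hk hA hfr hAO htr n hsing (ih hsing)
  refine exists_regular_le_of_capture O A hk hA hfr hAO hdimA m₁ hsing₁ X π hπ ?_
  intro i hi hsingi S hTS hdomS hSreg hSeft
  obtain ⟨d, rfl⟩ : ∃ d, i = d + 1 := ⟨i - 1, by omega⟩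
  exact RationalDescent.isPrincipal_map_ca_of_isRegularLocalRing_dominating hF O A hk hA hfr hAO htr d hsingi
    (hrat_of (d + 1) hi hsingi) S hTS hdomS hSreg hSeft

end Summit.ResolutionOfSingularities.ResolutionOfSingularities.Theorems.SurfaceTermination.CaptureDescent

end
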